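import Literature.AlgebraicGeometry.Motives.CubeOverNoetherianBaseSection
import Literature.AlgebraicGeometry.Motives.AbelianVarietyProduct
import Literature.AlgebraicGeometry.AbelianSchemes.AbelianSchemeKOfLClosedSubscheme
import Literature.AlgebraicGeometry.AbelianSchemes.AbelianSchemeKOfLLocal
import Literature.AlgebraicGeometry.AbelianSchemes.AbelianSchemeOverGeometricallyIntegral
import Literature.AlgebraicGeometry.Modules.LineBundleOfCocycleClass
import HarnessLib

/-!
# The theorem of the cube and the theorem of the square for an abelian scheme over a NOETHERIAN AFFINE base,
# UNCONDITIONAL (no dual pair, no reducedness, no connectedness of the base)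

Layer `Literature/AlgebraicGeometry/AbelianSchemes`, namespace `Literature.AlgebraicGeometry.AbelianSchemes.AbelianSchemeOver`
(with one generic lemma in `Literature.AlgebraicGeometry.Motives.SeesawRelative`).  THEOREMS ONLY (no definition, no named
fact, no instance, no notation, no `sorry`).  Cell `hodgecm-mathlib` (D-0151), F-DAG row F-2d «theorem of the square / cube
over a possibly NON-REDUCED base», road (R-def) FINAL BRICK γ1 «abelian specialisation» (author B-p07 (g17); census of
record `B-provers/B-p07/g16/CENSUS-Rdef-Gamma1-Abelian.B-p07g16.md`).

SETTING.  `R` a Noetherian ring, `A` an abelian scheme over `Spec R` (★ `AbelianSchemeOver`), `c ∈ Ȟ¹(A, 𝒪^×)` a class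
rigidified along the zero section (`ε^*c = 1`; e.g. `c = [L]` for `L` of rank one with `ε^*L ≅ 𝒪`), `[Λ]c = m^*c·(p₁^*c)⁻¹·(p₂^*c)⁻¹`
its MUMFORD CLASS on `A ×_R A` (★ `mumfordClass`, [MumfordFogartyKirwan1994] Ch. 6 §2 Def. 6.2).  For `T`-valued points
`x, y : T → A` write `Λ(x, y) := (x, y)^*[Λ]c = (x·y)^*c · (x^*c)⁻¹ · (y^*c)⁻¹` (★ `pullback_lift_mumfordClass`).  The CUBE CLASS
of three points is `Θ(x, y, z) := Λ(x, y·z) · Λ(x, y)⁻¹ · Λ(x, z)⁻¹ = (xyz)^*c · ((xy)^*c)⁻¹ · ((xz)^*c)⁻¹ · ((yz)^*c)⁻¹ · x^*c · y^*c · z^*c`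
([MumfordAV1970] §6 Cor. 2: «`Θ(L) = m_{123}^*L ⊗ m_{12}^*L⁻¹ ⊗ … ⊗ p_3^*L`»); it is spelled out INLINE everywhere (no definition).

* §1 `SeesawRelative.univStein_tensorObj` — universally Stein is stable under fibre products over the base; the abelian
  inputs of the relative cube: `geometricallyIntegral_tensorObj_hom_self` (`A ×_R A → Spec R` geometrically integral, ★
  `Motives.geometricallyIntegral_comp`), `isAffineHom_unit_left` (the zero section is affine), `exists_isPreconnected_fibre_mem`
  (every point of `A` lies in a connected fibre meeting the zero section).
* §2 the point calculus of `Θ`: `pullback_lift_one_right_mumfordClass` (`Λ(x, 1) = 1`), `pullback_left_cubeClass`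
  (`g^*Θ(x,y,z) = Θ(gx, gy, gz)`), `cubeClass_one_left/mid/right` (`Θ = 1` as soon as one argument is the unit point —
  Mumford's three faces, FORMAL from `ε^*c = 1`).
* §3 **`cubeClass_eq_one` — THE THEOREM OF THE CUBE over a Noetherian affine base, unconditional**: `Θ(x, y, z) = 1` in
  `Ȟ¹(T, 𝒪^×)` for ALL `R`-schemes `T` and all `x, y, z : T → A` ([MumfordAV1970] §6 Cor. 2 p. 58 over a field;
  [GortzWedhorn2023] Lemma 24.72 / [MumfordAV1970] §10 over a base).  PROOF: the universal case `T = (A ×_R A) ×_R A` with the three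
  projections; the rank-one module `N := 𝓛(Θ)` (★ `lineBundle`) on `(A ×_R A) ×_R A → A` is trivial on Mumford's three faces
  (§2), the relative seesaw closed subscheme of `N` EXISTS unconditionally (★ E12 `SeesawRelative.exists_seesawSubscheme`, inputs:
  `A ×_R A → Spec R` proper flat universally open geometrically integral and universally Stein, §1), so ★ γ0′
  `Motives.exists_iso_pullback_snd_of_faces_of_section` (the cube over a NON-reduced base, Mumford's form: faces + the zero
  section + connected fibres) gives `N ≅ pr_3^*𝓜`; restricting along the section `(0, 0, 𝟙) : A → (A × A) × A` kills `𝓜`.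
* §4 **`cechPic_pullback_whiskerLeft_mul_mumfordClass_of_isNoetherianRing` — THE THEOREM OF THE SQUARE, unconditional**:
  `(1 × (u·v))^*[Λ]c = (1 × u)^*[Λ]c · (1 × v)^*[Λ]c` on `A ×_R T` for all `u, v : T → A` ([MumfordAV1970] §6 Cor. 4;
  [MumfordFogartyKirwan1994] p. 120 «`Λ(L)` is a homomorphism») — it is `Θ(p_A, p_T ≫ u, p_T ≫ v) = 1`; module form
  `nonempty_pullback_whiskerLeft_mul_mumfordBundle_iso_of_isNoetherianRing` (`Λ(L)|_{u·v} ≅ Λ(L)|_u ⊗ Λ(L)|_v`).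
  Compare ★ `cechPic_pullback_whiskerLeft_mul_mumfordClass` / `nonempty_pullback_whiskerLeft_mul_mumfordBundle_iso`
  (`AbelianSchemeTheoremOfSquareOfDualPair`, road (R-dual)): the same conclusions CONDITIONAL on a dual pair `(D, hD)` and on
  `[IsLocallyNoetherian S] [PreconnectedSpace S]`; here NO dual pair and no connectedness, the base is affine Noetherian (the
  affineness and the universe `0` come from ★ E12's `{R : Type}`; globalising to a locally Noetherian `S` is local on `S`).

NOT here (recorded): the globalisation to a non-affine locally Noetherian base; the module `Θ(L)` on `A ×_S A ×_S A` as a named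
object (the cube is stated on CLASSES, with `Θ` spelled out inline); symmetry `Λ(x, y) = Λ(y, x)` (commutativity is not used).

HC_CM is proved only modulo the 7 printed citations until rung 0 closes; nothing here is about HC.

## References
* [MumfordAV1970] D. Mumford, *Abelian Varieties* (1970), §6 Theorem of the cube, Cor. 2 (p. 58), Cor. 4 (p. 59), §10 (p. 89),
  §13 (p. 123).
* [GortzWedhorn2023] U. Görtz, T. Wedhorn, *Algebraic Geometry II* (2023), Lemma 24.72 (p. 409), Cor. 24.63 (p. 404).
* [MumfordFogartyKirwan1994] D. Mumford, J. Fogarty, F. Kirwan, *Geometric Invariant Theory*, 3rd ed. (1994), Ch. 6 §1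
  Definition 6.1 (p. 115), §2 Definition 6.2 (p. 120), p. 121.
* [GortzWedhorn2020] U. Görtz, T. Wedhorn, *Algebraic Geometry I*, 2nd ed. (2020), Prop. 5.51 (p. 139).
* [Hartshorne1977] R. Hartshorne, *Algebraic Geometry* (1977), II Ex. 6.8, III Ex. 4.5.
-/

set_option autoImplicit false

noncomputable section

-- `Scheme.Modules` / `SheafOfModules` are not reducible; `(A.X ⊗ B.X).left = pullback _ _` holds by `rfl` only.
set_option backward.isDefEq.respectTransparency false

open CategoryTheory CategoryTheory.Limits AlgebraicGeometry MonoidalCategory CartesianMonoidalCategory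
open scoped MonObj

universe u

/-! ## §1 Products over the base: universally Stein, geometrically integral; the zero section; connected fibres -/

namespace Literature.AlgebraicGeometry.Motives

namespace SeesawRelative

/-- **Universally Stein is stable under fibre products over the base**: if `Γ(V, 𝒪_T) ⥲ Γ(X ×_R V, 𝒪)` and
`Γ(V, 𝒪_T) ⥲ Γ(Y ×_R V, 𝒪)` for all `R`-schemes `T` and opens `V ⊆ T`, then `Γ(V, 𝒪_T) ⥲ Γ((X ×_R Y) ×_R V, 𝒪)`:
`pr_T : (X × Y) × T → T` is `α ≫ pr_{Y × T} ≫ pr_T`, a composite of an isomorphism and two Stein projections.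
[cite: GortzWedhorn2023, Cor. 24.63 (p. 404)] -/
theorem univStein_tensorObj {R : Type} [CommRing R] (X Y : SchemeOver R) (hX : UnivStein X) (hY : UnivStein Y) :
    UnivStein (X ⊗ Y) := by
  intro T V
  have hsnd : snd (X ⊗ Y) T = (α_ X Y T).hom ≫ snd X (Y ⊗ T) ≫ snd Y T := by
    rw [associator_hom_snd_snd]
  rw [hsnd, Over.comp_left, Over.comp_left, Scheme.Hom.comp_app, Scheme.Hom.comp_app]
  haveI : IsIso (α_ X Y T).hom.left := inferInstance
  simp only [CommRingCat.hom_comp, RingHom.coe_comp]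
  exact ((ConcreteCategory.bijective_of_isIso _).comp (hX (Y ⊗ T) _)).comp (hY T V)

end SeesawRelative

end Literature.AlgebraicGeometry.Motives

namespace Literature.AlgebraicGeometry.AbelianSchemes

open Literature.AlgebraicGeometry.Motives Literature.AlgebraicGeometry.Modules
  Literature.AlgebraicGeometry.AbelianVarieties

namespace AbelianSchemeOver

section AnyBase

variable {S : Scheme.{u}} (A : AbelianSchemeOver S)

/-- **`A ×_S A → S` is geometrically integral**: `A ×_S A → A → S` is a flat universally open geometrically integral base
change followed by a geometrically integral morphism locally of finite type (★ `Motives.geometricallyIntegral_comp`,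
[GortzWedhorn2020] Prop. 5.51; ★ `geometricallyIntegral_hom_overBase`). [cite: GortzWedhorn2020, Prop. 5.51 (p. 139)] -/
theorem geometricallyIntegral_tensorObj_hom_self : GeometricallyIntegral (A.X ⊗ A.X).hom := by
  haveI : Smooth A.X.hom := A.isSmooth
  haveI : GeometricallyIntegral A.X.hom := A.geometricallyIntegral_hom_overBase
  haveI : Flat A.X.hom := inferInstance
  haveI : LocallyOfFinitePresentation A.X.hom := inferInstance
  haveI : UniversallyOpen A.X.hom := inferInstance
  change GeometricallyIntegral (pullback.fst A.X.hom A.X.hom ≫ A.X.hom)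
  exact geometricallyIntegral_comp _ _

/-- **The zero section `ε : S → A` is an affine morphism** (a section of the separated `A → S` is a closed immersion,
Mathlib `IsClosedImmersion.of_comp`). [cite: MumfordFogartyKirwan1994, Ch. 6 §1 Definition 6.1 (p. 115)] -/
theorem isAffineHom_unit_left : IsAffineHom (η[A.X]).left := by
  haveI : IsProper A.X.hom := A.isProper
  haveI : IsClosedImmersion ((η[A.X]).left ≫ A.X.hom) := by
    rw [Over.w (η[A.X]), Over.tensorUnit_hom]
    exact (inferInstance : IsClosedImmersion (𝟙 S))
  haveI : IsClosedImmersion (η[A.X]).left := IsClosedImmersion.of_comp _ A.X.hom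
  infer_instance

/-- **Every point of `A` lies in a preconnected subset of `A` meeting the zero section** — namely its fibre
`π⁻¹(π t)`, the continuous image of the connected scheme `A ×_S Spec κ(π t)` (★ `connectedSpace_pullback`; Mathlib
`Scheme.Hom.range_fiberι`), which contains `ε(π t)`. [cite: MumfordFogartyKirwan1994, Ch. 6 §1 Definition 6.1 (p. 115)] -/
theorem exists_isPreconnected_fibre_mem (t : A.X.left) :
    ∃ C : Set A.X.left, _root_.IsPreconnected C ∧ t ∈ C ∧ ∃ s : (𝟙_ (Over S)).left, (η[A.X]).left.base s ∈ C := by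
  refine ⟨A.X.hom.base ⁻¹' {A.X.hom.base t}, ?_, rfl, A.X.hom.base t, ?_⟩
  · rw [← Scheme.Hom.range_fiberι]
    haveI : ConnectedSpace ↥(A.X.hom.fiber (A.X.hom.base t)) :=
      A.connectedSpace_pullback _ (S.fromSpecResidueField (A.X.hom.base t))
    exact isPreconnected_range (A.X.hom.fiberι (A.X.hom.base t)).continuous
  · change (η[A.X].left ≫ A.X.hom).base (A.X.hom.base t) = A.X.hom.base t
    rw [Over.w (η[A.X]), Over.tensorUnit_hom]
    rfl

end AnyBase

/-! ## §2 The point calculus of the cube class -/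

section Points

variable {S : Scheme.{u}} (A : AbelianSchemeOver S) (c : CechPic A.left) {P : Over S}

/-- **`Λ(x, 1) = 1`** for `c` rigidified: `(x, 1)^*[Λ]c = (x·1)^*c · (x^*c)⁻¹ · (1^*c)⁻¹ = 1` (★ `pullback_lift_mumfordClass`,
★ `pullback_one_left`; companion of ★ `pullback_lift_one_mumfordClass`). [cite: MumfordFogartyKirwan1994, Ch. 6 §2 (p. 121)] -/
theorem pullback_lift_one_right_mumfordClass (hc : CechPic.pullback A.unitSection c = 1) (x : P ⟶ A.X) :
    CechPic.pullback (lift x (1 : P ⟶ A.X)).left (A.mumfordClass c) = 1 := by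
  rw [pullback_lift_mumfordClass, mul_one, A.pullback_one_left c hc, inv_one, mul_one, mul_inv_cancel]

/-- **Naturality of the cube class**: `g^*Θ(x, y, z) = Θ(g ≫ x, g ≫ y, g ≫ z)` for `g : Q → P` over `S`
(`g ≫ (x, y) = (g ≫ x, g ≫ y)`, `g ≫ (y·z) = (g ≫ y)·(g ≫ z)`). [cite: MumfordAV1970, §6 Cor. 2 (p. 58)] -/
theorem pullback_left_cubeClass {Q : Over S} (g : Q ⟶ P) (x y z : P ⟶ A.X) :
    CechPic.pullback g.left
        (CechPic.pullback (lift x (y * z)).left (A.mumfordClass c) *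
          (CechPic.pullback (lift x y).left (A.mumfordClass c))⁻¹ *
            (CechPic.pullback (lift x z).left (A.mumfordClass c))⁻¹) =
      CechPic.pullback (lift (g ≫ x) ((g ≫ y) * (g ≫ z))).left (A.mumfordClass c) *
        (CechPic.pullback (lift (g ≫ x) (g ≫ y)).left (A.mumfordClass c))⁻¹ *
          (CechPic.pullback (lift (g ≫ x) (g ≫ z)).left (A.mumfordClass c))⁻¹ := by
  rw [map_mul, map_mul, map_inv, map_inv, ← pullback_comp_left, ← pullback_comp_left, ← pullback_comp_left, comp_lift,
    comp_lift, comp_lift, MonObj.comp_mul]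

/-- **Face `x = 0`**: `Θ(1, y, z) = 1` (each `Λ(1, ·) = 1`, ★ `pullback_lift_one_mumfordClass`). [cite: MumfordAV1970, §6 (theorem of the cube and its proof)] -/
theorem cubeClass_one_left (hc : CechPic.pullback A.unitSection c = 1) (y z : P ⟶ A.X) :
    CechPic.pullback (lift (1 : P ⟶ A.X) (y * z)).left (A.mumfordClass c) *
        (CechPic.pullback (lift (1 : P ⟶ A.X) y).left (A.mumfordClass c))⁻¹ *
          (CechPic.pullback (lift (1 : P ⟶ A.X) z).left (A.mumfordClass c))⁻¹ = 1 := by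
  rw [A.pullback_lift_one_mumfordClass c hc, A.pullback_lift_one_mumfordClass c hc, A.pullback_lift_one_mumfordClass c hc,
    inv_one, mul_one, mul_one]

/-- **Face `y = 0`**: `Θ(x, 1, z) = Λ(x, z) · Λ(x, 1)⁻¹ · Λ(x, z)⁻¹ = 1`. [cite: MumfordAV1970, §6 (theorem of the cube and its proof)] -/
theorem cubeClass_one_mid (hc : CechPic.pullback A.unitSection c = 1) (x z : P ⟶ A.X) :
    CechPic.pullback (lift x ((1 : P ⟶ A.X) * z)).left (A.mumfordClass c) *
        (CechPic.pullback (lift x (1 : P ⟶ A.X)).left (A.mumfordClass c))⁻¹ *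
          (CechPic.pullback (lift x z).left (A.mumfordClass c))⁻¹ = 1 := by
  rw [one_mul, A.pullback_lift_one_right_mumfordClass c hc, inv_one, mul_one, mul_inv_cancel]

/-- **Face `z = 0`**: `Θ(x, y, 1) = Λ(x, y) · Λ(x, y)⁻¹ · Λ(x, 1)⁻¹ = 1`. [cite: MumfordAV1970, §6 (theorem of the cube and its proof)] -/
theorem cubeClass_one_right (hc : CechPic.pullback A.unitSection c = 1) (x y : P ⟶ A.X) :
    CechPic.pullback (lift x (y * (1 : P ⟶ A.X))).left (A.mumfordClass c) *
        (CechPic.pullback (lift x y).left (A.mumfordClass c))⁻¹ *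
          (CechPic.pullback (lift x (1 : P ⟶ A.X)).left (A.mumfordClass c))⁻¹ = 1 := by
  rw [mul_one, mul_inv_cancel, one_mul, A.pullback_lift_one_right_mumfordClass c hc, inv_one]

/-- **The Mumford family along `u` is `Λ` at the point `(p_A, p_T ≫ u)`**: `1_A × u = (p_A, p_T ≫ u) : A ×_S T → A ×_S A`.
[cite: MumfordFogartyKirwan1994, Ch. 6 §2 Definition 6.2 (p. 120)] -/
theorem whiskerLeft_eq_lift {T : Over S} (u : T ⟶ A.X) : A.X ◁ u = lift (fst A.X T) (snd A.X T ≫ u) := by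
  ext <;> simp

end Points

/-! ## §3 The theorem of the cube over a Noetherian affine base -/

section Cube

variable {R : Type} [CommRing R] [IsNoetherianRing R] (A : AbelianSchemeOver (Spec (.of R))) (c : CechPic A.left)

/-- **A rank-one module is trivial along `f` as soon as its class pulls back to `1`** (class currency ↔ module currency:
★ `detClass_pullback`, ★ `nonempty_iso_unitModule_of_detClass_eq_one`, ★ `detClass_lineBundle`).
[cite: Hartshorne1977, III Ex. 4.5] -/
theorem nonempty_unit_iso_pullback_lineBundle_of_pullback_eq_one {X Y : Scheme.{u}} (f : Y ⟶ X) (c₀ : UnitCocycle X)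
    (h : CechPic.pullback f (CechPic.mk c₀) = 1) :
    Nonempty (unitModule Y ≅ (Scheme.Modules.pullback f).obj (lineBundle c₀)) := by
  have h1 : HasRank ((Scheme.Modules.pullback f).obj (lineBundle c₀)) 1 := hasRank_pullback f c₀.hasRank_lineBundle
  obtain ⟨e⟩ := nonempty_iso_unitModule_of_detClass_eq_one h1 (c₀.isFiniteLocallyFree_lineBundle.pullback f)
    (by rw [detClass_pullback f c₀.isFiniteLocallyFree_lineBundle, c₀.detClass_lineBundle, h])
  exact ⟨e.symm⟩

/-- **THE THEOREM OF THE CUBE for an abelian scheme over a Noetherian affine base — UNCONDITIONAL** ([MumfordAV1970] §6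
Cor. 2 over a field; over a base [MumfordAV1970] §10 / [GortzWedhorn2023] Lemma 24.72): for `c ∈ Ȟ¹(A, 𝒪^×)` with `ε^*c = 1`,
every `R`-scheme `T` and all `x, y, z : T → A`,
`Θ(x, y, z) = Λ(x, y·z) · Λ(x, y)⁻¹ · Λ(x, z)⁻¹ = 1` in `Ȟ¹(T, 𝒪^×)`, where `Λ(x, y) = (x, y)^*[Λ]c = (x·y)^*c·(x^*c)⁻¹·(y^*c)⁻¹`
— i.e. `(xyz)^*c ⊗ (xy)^*c⁻¹ ⊗ (xz)^*c⁻¹ ⊗ (yz)^*c⁻¹ ⊗ x^*c ⊗ y^*c ⊗ z^*c` is trivial.  Proof: universal case `T = (A × A) × A`;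
the line bundle of `Θ` is trivial on the three faces (§2), the relative seesaw subscheme EXISTS (★ `SeesawRelative.exists_seesawSubscheme`
for `A × A → Spec R`, inputs §1), so the cube over a non-reduced base in Mumford's form (★ `exists_iso_pullback_snd_of_faces_of_section`:
faces + zero section + connected fibres of `A → Spec R`) gives `𝓛(Θ) ≅ pr₃^*𝓜`, and the section `(0, 0, 𝟙_A)` kills `𝓜`.
[cite: MumfordAV1970, §6 (theorem of the cube and its proof) and §10 (p. 89)] [cite: GortzWedhorn2023, Lemma 24.72 (p. 409)] -/
theorem cubeClass_eq_one (hc : CechPic.pullback A.unitSection c = 1) {P : Over (Spec (.of R))} (x y z : P ⟶ A.X) :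
    CechPic.pullback (lift x (y * z)).left (A.mumfordClass c) *
        (CechPic.pullback (lift x y).left (A.mumfordClass c))⁻¹ *
          (CechPic.pullback (lift x z).left (A.mumfordClass c))⁻¹ = 1 := by
  -- instances on `A → Spec R` and `A × A → Spec R`
  haveI : IsProper A.X.hom := A.isProper
  haveI : Smooth A.X.hom := A.isSmooth
  haveI : GeometricallyIntegral A.X.hom := A.geometricallyIntegral_hom_overBase
  haveI : Flat A.X.hom := inferInstance
  haveI : LocallyOfFinitePresentation A.X.hom := inferInstance
  haveI : UniversallyOpen A.X.hom := inferInstance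
  haveI : IsLocallyNoetherian A.X.left := LocallyOfFiniteType.isLocallyNoetherian A.X.hom
  haveI : IsProper (A.X ⊗ A.X).hom := by
    change IsProper (pullback.fst A.X.hom A.X.hom ≫ A.X.hom); infer_instance
  haveI : Flat (A.X ⊗ A.X).hom := by
    change Flat (pullback.fst A.X.hom A.X.hom ≫ A.X.hom); infer_instance
  haveI : UniversallyOpen (A.X ⊗ A.X).hom := by
    change UniversallyOpen (pullback.fst A.X.hom A.X.hom ≫ A.X.hom); infer_instance
  haveI : GeometricallyIntegral (A.X ⊗ A.X).hom := A.geometricallyIntegral_tensorObj_hom_self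
  haveI : IsAffineHom (η[A.X]).left := A.isAffineHom_unit_left
  have hSt : SeesawRelative.UnivStein A.X := A.univStein_of_isNoetherianRing
  have hSt2 : SeesawRelative.UnivStein (A.X ⊗ A.X) := SeesawRelative.univStein_tensorObj A.X A.X hSt hSt
  -- the universal cube class `Θ` on `(A × A) × A` and its line bundle `N`
  obtain ⟨Θ, hΘ⟩ : ∃ Θ : CechPic ((A.X ⊗ A.X) ⊗ A.X).left, Θ =
      CechPic.pullback (lift (fst (A.X ⊗ A.X) A.X ≫ fst A.X A.X)
          ((fst (A.X ⊗ A.X) A.X ≫ snd A.X A.X) * snd (A.X ⊗ A.X) A.X)).left (A.mumfordClass c) *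
        (CechPic.pullback (lift (fst (A.X ⊗ A.X) A.X ≫ fst A.X A.X) (fst (A.X ⊗ A.X) A.X ≫ snd A.X A.X)).left
            (A.mumfordClass c))⁻¹ *
          (CechPic.pullback (lift (fst (A.X ⊗ A.X) A.X ≫ fst A.X A.X) (snd (A.X ⊗ A.X) A.X)).left
            (A.mumfordClass c))⁻¹ := ⟨_, rfl⟩
  -- naturality of `Θ` along any `g : Q → (A × A) × A`
  have hnat : ∀ {Q : Over (Spec (.of R))} (g : Q ⟶ (A.X ⊗ A.X) ⊗ A.X), CechPic.pullback g.left Θ =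
      CechPic.pullback (lift (g ≫ fst _ _ ≫ fst _ _) ((g ≫ fst _ _ ≫ snd _ _) * (g ≫ snd _ _))).left (A.mumfordClass c) *
        (CechPic.pullback (lift (g ≫ fst _ _ ≫ fst _ _) (g ≫ fst _ _ ≫ snd _ _)).left (A.mumfordClass c))⁻¹ *
          (CechPic.pullback (lift (g ≫ fst _ _ ≫ fst _ _) (g ≫ snd _ _)).left (A.mumfordClass c))⁻¹ := by
    intro Q g
    rw [hΘ, A.pullback_left_cubeClass]
  obtain ⟨c₃, hc₃⟩ := CechPic.mk_surjective Θ
  have hN : HasRank (lineBundle c₃) 1 := c₃.hasRank_lineBundle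
  haveI : (lineBundle c₃).IsQuasicoherent := isQuasicoherent_of_hasRank hN
  -- the three faces
  have h₁ : Nonempty (unitModule _ ≅
      (Scheme.Modules.pullback (((λ_ A.X).inv ≫ η[A.X] ▷ A.X) ▷ A.X).left).obj (lineBundle c₃)) := by
    refine nonempty_unit_iso_pullback_lineBundle_of_pullback_eq_one _ c₃ ?_
    rw [hc₃, hnat]
    have e1 : (((λ_ A.X).inv ≫ η[A.X] ▷ A.X) ▷ A.X) ≫ fst _ _ ≫ fst _ _ = (1 : A.X ⊗ A.X ⟶ A.X) := by
      rw [Hom.one_def]; simp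
    have e2 : (((λ_ A.X).inv ≫ η[A.X] ▷ A.X) ▷ A.X) ≫ fst _ _ ≫ snd _ _ = fst A.X A.X := by simp
    have e3 : (((λ_ A.X).inv ≫ η[A.X] ▷ A.X) ▷ A.X) ≫ snd _ _ = snd A.X A.X := by simp
    rw [e1, e2, e3]
    exact A.cubeClass_one_left c hc _ _
  have h₂ : Nonempty (unitModule _ ≅
      (Scheme.Modules.pullback (((ρ_ A.X).inv ≫ A.X ◁ η[A.X]) ▷ A.X).left).obj (lineBundle c₃)) := by
    refine nonempty_unit_iso_pullback_lineBundle_of_pullback_eq_one _ c₃ ?_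
    rw [hc₃, hnat]
    have e1 : (((ρ_ A.X).inv ≫ A.X ◁ η[A.X]) ▷ A.X) ≫ fst _ _ ≫ fst _ _ = fst A.X A.X := by simp
    have e2 : (((ρ_ A.X).inv ≫ A.X ◁ η[A.X]) ▷ A.X) ≫ fst _ _ ≫ snd _ _ = (1 : A.X ⊗ A.X ⟶ A.X) := by
      rw [Hom.one_def]; simp
    have e3 : (((ρ_ A.X).inv ≫ A.X ◁ η[A.X]) ▷ A.X) ≫ snd _ _ = snd A.X A.X := by simp
    rw [e1, e2, e3]
    exact A.cubeClass_one_mid c hc _ _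
  have h₃ : Nonempty (unitModule _ ≅
      (Scheme.Modules.pullback ((A.X ⊗ A.X) ◁ η[A.X]).left).obj (lineBundle c₃)) := by
    refine nonempty_unit_iso_pullback_lineBundle_of_pullback_eq_one _ c₃ ?_
    rw [hc₃, hnat]
    have e1 : ((A.X ⊗ A.X) ◁ η[A.X]) ≫ fst _ _ ≫ fst _ _ = fst (A.X ⊗ A.X) _ ≫ fst A.X A.X := by simp
    have e2 : ((A.X ⊗ A.X) ◁ η[A.X]) ≫ fst _ _ ≫ snd _ _ = fst (A.X ⊗ A.X) _ ≫ snd A.X A.X := by simp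
    have e3 : ((A.X ⊗ A.X) ◁ η[A.X]) ≫ snd _ _ = (1 : (A.X ⊗ A.X) ⊗ 𝟙_ _ ⟶ A.X) := by
      rw [Hom.one_def, whiskerLeft_snd, toUnit_unique (snd _ _) (toUnit _)]
    rw [e1, e2, e3]
    exact A.cubeClass_one_right c hc _ _
  -- the relative seesaw subscheme of `N` for the family `(A × A) × A → A` exists (★ E12)
  obtain ⟨Z, i, hi, huniv⟩ := SeesawRelative.exists_seesawSubscheme (A.X ⊗ A.X) hSt2 A.X (lineBundle c₃) hN
  -- the cube over a non-reduced base, Mumford's form (★ γ0′)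
  obtain ⟨𝓜, -, h𝓜, ⟨e⟩⟩ := exists_iso_pullback_snd_of_faces_of_section A.X A.X A.X hSt hSt η[A.X] η[A.X]
    (lineBundle c₃) hN i huniv h₁ h₂ η[A.X] h₃ A.exists_isPreconnected_fibre_mem
  -- `Θ = pr₃^*[𝓜]`
  have hΘm : Θ = CechPic.pullback (snd (A.X ⊗ A.X) A.X).left (detClass (HasRank.isFiniteLocallyFree' h𝓜)) := by
    rw [← hc₃, ← c₃.detClass_lineBundle, ← detClass_pullback]
    exact detClass_eq_of_iso e _ _
  -- the section `(0, 0, 𝟙) : A → (A × A) × A` kills `[𝓜]`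
  have hm : detClass (HasRank.isFiniteLocallyFree' h𝓜) = 1 := by
    have key := congrArg (CechPic.pullback (lift (lift (1 : A.X ⟶ A.X) (1 : A.X ⟶ A.X)) (𝟙 A.X)).left) hΘm
    rw [← pullback_comp_left, lift_snd, Over.id_left, CechPic.pullback_id_apply, hnat] at key
    have e1 : lift (lift (1 : A.X ⟶ A.X) (1 : A.X ⟶ A.X)) (𝟙 A.X) ≫ fst _ _ ≫ fst _ _ = 1 := by simp
    have e2 : lift (lift (1 : A.X ⟶ A.X) (1 : A.X ⟶ A.X)) (𝟙 A.X) ≫ fst _ _ ≫ snd _ _ = 1 := by simp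
    rw [e1, e2, A.cubeClass_one_left c hc] at key
    exact key.symm
  have hΘ1 : Θ = 1 := by rw [hΘm, hm, map_one]
  -- evaluate at `(x, y, z) : P → (A × A) × A`
  have key := hnat (lift (lift x y) z)
  rw [hΘ1, map_one] at key
  have e1 : lift (lift x y) z ≫ fst _ _ ≫ fst _ _ = x := by simp
  have e2 : lift (lift x y) z ≫ fst _ _ ≫ snd _ _ = y := by simp
  have e3 : lift (lift x y) z ≫ snd _ _ = z := by simp
  rw [e1, e2, e3] at key
  exact key.symm

/-! ## §4 The theorem of the square over a Noetherian affine base -/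

/-- **THE THEOREM OF THE SQUARE for an abelian scheme over a Noetherian affine base — UNCONDITIONAL** (class form): for
`c ∈ Ȟ¹(A, 𝒪^×)` rigidified along the zero section and all `u, v : T → A` over `Spec R`,
`(1_A × (u·v))^*[Λ]c = (1_A × u)^*[Λ]c · (1_A × v)^*[Λ]c` in `Ȟ¹(A ×_R T, 𝒪^×)` — [MumfordAV1970] §6 Cor. 4 «theorem of the
square», [MumfordFogartyKirwan1994] Ch. 6 §2 p. 120 «`Λ(L)` is a homomorphism `X → Pic(X/S)`» — the cube (`cubeClass_eq_one`)
at the points `(p_A, p_T ≫ u, p_T ≫ v)` of `A ×_R T`.  No dual pair, no reducedness or connectedness of the base (compare ★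
`cechPic_pullback_whiskerLeft_mul_mumfordClass`). [cite: MumfordAV1970, §6 Cor. 4 (p. 59)] [cite: MumfordFogartyKirwan1994, Ch. 6 §2 Definition 6.2 (p. 120)] -/
theorem cechPic_pullback_whiskerLeft_mul_mumfordClass_of_isNoetherianRing (hc : CechPic.pullback A.unitSection c = 1)
    {T : Over (Spec (.of R))} (u v : T ⟶ A.X) :
    CechPic.pullback (A.X ◁ (u * v)).left (AbelianSchemeOver.mumfordClass A c) =
      CechPic.pullback (A.X ◁ u).left (AbelianSchemeOver.mumfordClass A c) *
        CechPic.pullback (A.X ◁ v).left (AbelianSchemeOver.mumfordClass A c) := by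
  have key := A.cubeClass_eq_one c hc (fst A.X T) (snd A.X T ≫ u) (snd A.X T ≫ v)
  rw [← MonObj.comp_mul, ← A.whiskerLeft_eq_lift, ← A.whiskerLeft_eq_lift, ← A.whiskerLeft_eq_lift, mul_inv_eq_one,
    mul_inv_eq_iff_eq_mul] at key
  rw [key, mul_comm]

/-- **THE THEOREM OF THE SQUARE, module form — UNCONDITIONAL over a Noetherian affine base**: for `L` of rank one on `A`
rigidified along the zero section and all `u, v : T → A` over `Spec R`, `Λ(L)|_{u·v} ≅ Λ(L)|_u ⊗ Λ(L)|_v` on `A ×_R T`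
(`Λ(L)|_w = (1_A × w)^*Λ(L)`, ★ `mumfordBundle`; rank-one modules are classified by their classes, ★ `nonempty_iso_iff_detClass_eq`).
[cite: MumfordAV1970, §6 Cor. 4 (p. 59)] [cite: MumfordFogartyKirwan1994, Ch. 6 §2 Definition 6.2 (p. 120)] -/
theorem nonempty_pullback_whiskerLeft_mul_mumfordBundle_iso_of_isNoetherianRing {L : A.left.Modules} (hL : HasRank L 1)
    (hε : CechPic.pullback A.unitSection (detClass (HasRank.isFiniteLocallyFree' hL)) = 1)
    {T : Over (Spec (.of R))} (u v : T ⟶ A.X) :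
    Nonempty ((Scheme.Modules.pullback (A.X ◁ (u * v)).left).obj (AbelianSchemeOver.mumfordBundle A L) ≅
      tensorObj ((Scheme.Modules.pullback (A.X ◁ u).left).obj (AbelianSchemeOver.mumfordBundle A L))
        ((Scheme.Modules.pullback (A.X ◁ v).left).obj (AbelianSchemeOver.mumfordBundle A L))) := by
  have hΛ : IsFiniteLocallyFree (A.mumfordBundle L) := HasRank.isFiniteLocallyFree' (A.hasRank_mumfordBundle hL)
  have h1 : ∀ w : T ⟶ A.X, HasRank ((Scheme.Modules.pullback (A.X ◁ w).left).obj (A.mumfordBundle L)) 1 :=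
    fun w => hasRank_pullback _ (A.hasRank_mumfordBundle hL)
  refine (nonempty_iso_iff_detClass_eq (h1 (u * v)) (hasRank_tensorObj_one (h1 u) (h1 v)) (hΛ.pullback _)
    (isFiniteLocallyFree_tensorObj _ _ (hΛ.pullback _) (hΛ.pullback _))).2 ?_
  rw [detClass_tensorObj_of_hasRank_one (h1 u) (h1 v) (hΛ.pullback _) (hΛ.pullback _), detClass_pullback _ hΛ,
    detClass_pullback _ hΛ, detClass_pullback _ hΛ, A.detClass_mumfordBundle hL hΛ]
  exact A.cechPic_pullback_whiskerLeft_mul_mumfordClass_of_isNoetherianRing _ hε u v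

end Cube

end AbelianSchemeOver

end Literature.AlgebraicGeometry.AbelianSchemes

end
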